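import Summits.CriticalPhenomena.Ising3DConformalLimit.Theorems.EnergyNotSigmaSquaredEnergyGapSoftPairings
import Literature.Probability.LatticeModels.PlusFreeComparison

/-!
# `EnergyGapSoft`: the exact closed-bond probability of the sourced double current
(item stmt-CriticalPhenomena-4473, route `EnergyNotSigmaSquared`; sequel to
`EnergyNotSigmaSquaredEnergyGapSoftMerging` / `…Pairings`, continued in `…BondFloor`)

Notation as there: `G = criticalTwoPoint 3`, `e₂ = Pi.single 1 1`, `β_c = criticalBeta 3`, and
`P^{A,B}_β = sourcedDoubleCurrentLawInf d β A B` is the infinite-volume sourced double random current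
read on the trace `ω = n̂₁ ∪ n̂₂`; `A_par(x) = 1 - P^{{0}∆{x},{e₂}∆{x+e₂}}_{β_c}[0 ↔ e₂]`,
`A_cross(x) = 1 - P^{{0}∆{x+e₂},{e₂}∆{x}}_{β_c}[0 ↔ e₂]`; the item is `A_par, A_cross → 0`
(`energyGapSoft_iff_adjacentMerging`).

This file computes EXACTLY the infinite-volume probability that a given lattice bond is closed in
the trace (the scale-zero ingredient of every merging estimate):

* `sourcedDoubleCurrentLawInf_real_bond_closed` (any `d`, `β > 0`, even sources, PROVED) —
  `P^{A,B}_β[uv ∉ ω] = (cosh β - sinh β ⟨σ_{A∆{u}∆{v}}⟩⁰_β/⟨σ_A⟩⁰_β) (cosh β - sinh β ⟨σ_{B∆{u}∆{v}}⟩⁰_β/⟨σ_B⟩⁰_β)`: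
  the ADS15 avoidance formula `P^A_Λ[n_{uv} = 0] = ⟨σ_A e^{-βσ_uσ_v}⟩_Λ/⟨σ_A⟩_Λ` for each current
  (tree: `tendsto_sourcedAvoid`), the product structure on cylinders
  (`sourcedDoubleCurrentLaw_real_localCylinder_eq`), and the passage `Λ_L ↑ ℤ^d` on this LOCAL event;
* `tanh_criticalBeta_le_criticalTwoPoint_e₂` — `tanh β_c ≤ ⟨σ₀σ_{e₂}⟩_{β_c}` on `ℤ³` (nonnegativity of
  that probability for the sources `A = {0,e₂}`, `B = ∅`);
* `one_sub_openConn_le_bondClosed` — not merging forces the bond `0e₂` to be closed;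
* `parBondClosed_eq`, `crossBondClosed_eq` — at `β_c` on `ℤ³`, for the two pairings of the item,
  `P[0e₂ ∉ ω] = (cosh β_c - sinh β_c G(x-e₂)/G(x)) (cosh β_c - sinh β_c G(x+e₂)/G(x))`, resp.
  `(cosh β_c - sinh β_c G(x)/G(x+e₂)) (cosh β_c - sinh β_c G(x)/G(x-e₂))`.

Nothing here asserts the item.

## References

* M. Aizenman, H. Duminil-Copin, V. Sidoravicius, Comm. Math. Phys. 334 (2015), §2.2
  eqs. (2.13)–(2.14), Thm. 2.3 [AizenmanDuminilCopinSidoraviciusCMP2015].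
* M. Aizenman, H. Duminil-Copin, Ann. of Math. 194 (2021), §3.1–3.2 [AizenmanDuminilCopinAnnals2021].
* S. Friedli, Y. Velenik, *Statistical Mechanics of Lattice Systems* (CUP 2017), Thm. 3.20
  [FriedliVelenik2017].
-/

noncomputable section

namespace Summit.CriticalPhenomena.Ising3DConformalLimit.EnergyNotSigmaSquaredEnergyGapSoft

open scoped symmDiff
open MeasureTheory Filter Topology Finset
open Literature.Probability.LatticeModels Literature.Probability.Percolation
open Summit.CriticalPhenomena.Ising3DConformalLimit.Theses.EnergyNotSigmaSquared
open Summit.CriticalPhenomena.Ising3DConformalLimit.PinnedClusterPoints (criticalTwoPoint_pos3)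

/-! ### The closed-bond event is a cylinder -/

/-- The event "the coordinate `b` is off" is the cylinder over `{b}` with the empty pattern.
[folklore] -/
theorem setOf_notMem_eq_localCylinder {ι : Type*} (b : ι) :
    {ω : Set ι | b ∉ ω} = localCylinder (↑({b} : Finset ι) : Set ι) ↑(∅ : Finset ι) := by
  ext ω
  rw [mem_localCylinder_coe_iff]
  simp

/-- The power set of a singleton. [folklore] -/
theorem powerset_singleton' {α : Type*} [DecidableEq α] (a : α) :
    ({a} : Finset α).powerset = {∅, {a}} := by
  ext s
  rw [Finset.mem_powerset, Finset.subset_singleton_iff, Finset.mem_insert, Finset.mem_singleton]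

/-- `bondsSupport` of a single lattice bond is the pair of its endpoints. [folklore] -/
theorem bondsSupport_singleton {d : ℕ} {u v : Site d} (huv : u ≠ v) :
    bondsSupport d ({s(u, v)} : Finset (Sym2 (Site d))) = {u} ∆ {v} := by
  ext w
  simp only [bondsSupport, Finset.fold_singleton, Sym2.toFinset_mk_eq, Finset.mem_symmDiff,
    Finset.mem_insert, Finset.mem_singleton, Finset.notMem_empty, not_false_eq_true, and_true,
    false_and, or_false]
  constructor
  · rintro (rfl | rfl)
    · exact Or.inl ⟨rfl, huv⟩
    · exact Or.inr ⟨rfl, fun h => huv h.symm⟩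
  · rintro (⟨h, -⟩ | ⟨h, -⟩)
    · exact Or.inl h
    · exact Or.inr h

/-! ### The exact closed-bond probability of the infinite-volume sourced double current -/

/-- The ADS15 single-bond sum: for a finite `C ⊂ ℤ^d` and a lattice bond `uv`,
`∑_{R ⊆ {uv}} cosh β (-sinh β)^{|R|}/cosh(β)^{|R|} ⟨σ_{C ∆ A(R)}⟩⁰_β = cosh β ⟨σ_C⟩⁰_β - sinh β ⟨σ_{C∆{u}∆{v}}⟩⁰_β`.
[cite: AizenmanDuminilCopinSidoraviciusCMP2015, §2.2, eq. (2.14)] -/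
theorem sum_powerset_singleton_bond {d : ℕ} (β : ℝ) (C : Finset (Site d)) {u v : Site d}
    (huv : u ≠ v) :
    (∑ R ∈ ({s(u, v)} : Finset (Sym2 (Site d))).powerset,
        Real.cosh β ^ #({s(u, v)} : Finset (Sym2 (Site d))) * (-Real.sinh β) ^ #R / Real.cosh β ^ #R *
          freeCorr d β 0 (C ∆ bondsSupport d R)) =
      Real.cosh β * freeCorr d β 0 C - Real.sinh β * freeCorr d β 0 (C ∆ ({u} ∆ {v})) := by
  have hne : (∅ : Finset (Sym2 (Site d))) ≠ {s(u, v)} := (Finset.singleton_ne_empty _).symm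
  rw [powerset_singleton', Finset.sum_pair hne, bondsSupport_singleton huv]
  have h0 : bondsSupport d (∅ : Finset (Sym2 (Site d))) = ∅ := rfl
  rw [h0]
  have hC : C ∆ (∅ : Finset (Site d)) = C := by simp
  rw [hC]
  have hcosh : Real.cosh β ≠ 0 := (Real.cosh_pos β).ne'
  simp only [Finset.card_empty, Finset.card_singleton, pow_zero, pow_one, div_one, mul_one]
  field_simp
  ring

/-- **The exact probability that a lattice bond is closed in the trace of the infinite-volume
sourced double current.**  For `β > 0`, finite `A, B ⊂ ℤ^d` of even cardinality and a lattice bond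
`uv`,
`P^{A,B}_β[uv ∉ n̂₁ ∪ n̂₂] = (cosh β - sinh β ⟨σ_{A∆{u,v}}⟩⁰_β/⟨σ_A⟩⁰_β) (cosh β - sinh β ⟨σ_{B∆{u,v}}⟩⁰_β/⟨σ_B⟩⁰_β)`:
in the box, `P^A_Λ[n_{uv} = 0] = Z_{Λ∖uv}(A)/Z_Λ(A) = ⟨σ_A e^{-βσ_uσ_v}⟩_Λ/⟨σ_A⟩_Λ` (ADS15
(2.13)–(2.14)) and `e^{-βσ_uσ_v} = cosh β - sinh β σ_uσ_v`; the two currents are independent and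
`{uv ∉ ω}` is a local event, on which `P^{A,B}_{Λ_L,β} → P^{A,B}_β`.
[cite: AizenmanDuminilCopinSidoraviciusCMP2015, §2.2, eqs. (2.13)–(2.14)] -/
theorem sourcedDoubleCurrentLawInf_real_bond_closed {d : ℕ} {β : ℝ} (hβ : 0 < β)
    {A B : Finset (Site d)} (hA : Even #A) (hB : Even #B) {u v : Site d}
    (huv : (zdGraph d).Adj u v) :
    (sourcedDoubleCurrentLawInf d β A B).real {ω | s(u, v) ∉ ω} =
      ((Real.cosh β * freeCorr d β 0 A - Real.sinh β * freeCorr d β 0 (A ∆ ({u} ∆ {v}))) /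
          freeCorr d β 0 A) *
        ((Real.cosh β * freeCorr d β 0 B - Real.sinh β * freeCorr d β 0 (B ∆ ({u} ∆ {v}))) /
          freeCorr d β 0 B) := by
  classical
  have hne : u ≠ v := huv.ne
  have hT : (↑({s(u, v)} : Finset (Sym2 (Site d))) : Set (Sym2 (Site d))) ⊆ (zdGraph d).edgeSet := by
    intro e he
    rw [Finset.coe_singleton, Set.mem_singleton_iff] at he
    rw [he, SimpleGraph.mem_edgeSet]
    exact huv
  have hS := setOf_notMem_eq_localCylinder (ι := Sym2 (Site d)) s(u, v)
  -- the defining limit of `P^{A,B}_β` on the local event `{uv ∉ ω}`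
  have hlim1 : Tendsto (fun L : ℕ => (sourcedDoubleCurrentLaw d L β A B).real {ω | s(u, v) ∉ ω})
      atTop (𝓝 ((sourcedDoubleCurrentLawInf d β A B).real {ω | s(u, v) ∉ ω})) := by
    rw [hS]
    exact tendsto_sourcedDoubleCurrentLaw_real_of_even hβ hA hB (isLocalEvent_localCylinder _ _)
  -- the single-current avoidance probabilities converge (ADS15 with sources)
  have havA := tendsto_sourcedAvoid d hβ hT hA
  have havB := tendsto_sourcedAvoid d hβ hT hB
  rw [sum_powerset_singleton_bond β A hne] at havA
  rw [sum_powerset_singleton_bond β B hne] at havB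
  -- in a large box the closed-bond probability is the product of the two avoidance probabilities
  obtain ⟨L₀, hL₀⟩ := exists_forall_subset_box d (A ∪ B)
  have hlim2 : Tendsto (fun L : ℕ => (sourcedDoubleCurrentLaw d L β A B).real {ω | s(u, v) ∉ ω})
      atTop (𝓝 (((Real.cosh β * freeCorr d β 0 A - Real.sinh β * freeCorr d β 0 (A ∆ ({u} ∆ {v}))) /
          freeCorr d β 0 A) *
        ((Real.cosh β * freeCorr d β 0 B - Real.sinh β * freeCorr d β 0 (B ∆ ({u} ∆ {v}))) /
          freeCorr d β 0 B))) := by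
    refine (havA.mul havB).congr' ?_
    filter_upwards [eventually_subset_edgesIn d hT, eventually_ge_atTop L₀] with L hL hL'
    have hAL : A ⊆ box d L := Finset.subset_union_left.trans (hL₀ L hL')
    have hBL : B ⊆ box d L := Finset.subset_union_right.trans (hL₀ L hL')
    rw [hS, sourcedDoubleCurrentLaw_real_localCylinder_eq d L hβ.le
      (currentSum_boxSources_pos d hβ hAL hA).ne' (currentSum_boxSources_pos d hβ hBL hB).ne'
      (Finset.empty_subset _), Finset.powerset_empty, Finset.sum_singleton, Finset.sum_singleton,
      if_pos (Finset.union_empty ∅), sourcedTrace_eq_sum d L β A (Finset.empty_subset _),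
      sourcedTrace_eq_sum d L β B (Finset.empty_subset _), Finset.powerset_empty, Finset.sum_singleton,
      Finset.sum_singleton, Finset.sdiff_empty, Finset.union_empty]
    simp
  exact tendsto_nhds_unique hlim1 hlim2

/-! ### Specialisation to `ℤ³` at `β_c` -/

/-- The free (= plus) pair correlation at `β_c` on `ℤ³` is the critical two-point function:
`⟨σ_{{a}∆{b}}⟩⁰_{β_c} = G(b - a)`. [folklore] -/
theorem freeCorr_criticalBeta_pair (a b : Site 3) :
    freeCorr 3 (criticalBeta 3) 0 ({a} ∆ {b}) = criticalTwoPoint 3 (b - a) := by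
  rw [← freeExpect_spinMonomial_two_eq_freeCorr, freeExpect_criticalBeta_spinMonomial (by norm_num),
    criticalCorr_two_pair]

/-- `⟨σ_∅⟩⁰_{β_c} = 1`. [folklore] -/
theorem freeCorr_criticalBeta_empty : freeCorr 3 (criticalBeta 3) 0 ∅ = 1 :=
  freeCorr_empty (d := 3) (criticalBeta_nonneg 3) le_rfl

/-- `0` and `e₂` are neighbours in `ℤ³`. [folklore] -/
theorem zdGraph_adj_zero_e₂ : (zdGraph 3).Adj (0 : Site 3) (Pi.single 1 1) :=
  (zdGraph_adj_iff _ _).2 ⟨1, Or.inl (by simp)⟩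

/-- `β_c(3) > 0`. [folklore] -/
theorem criticalBeta_three_pos : 0 < criticalBeta 3 := criticalBeta_pos_holds (d := 3) (by norm_num)

/-- **`tanh β_c ≤ ⟨σ₀σ_{e₂}⟩_{β_c}`** on `ℤ³`: the closed-bond probability
`P^{{0,e₂},∅}_{β_c}[0e₂ ∉ ω] = (cosh β_c - sinh β_c/G(e₂)) (cosh β_c - sinh β_c G(e₂))` is nonnegative
and its second factor is at least `e^{-β_c} > 0`. [cite: FriedliVelenik2017, Thm. 3.20, eq. (3.22), p. 109] -/
theorem tanh_criticalBeta_le_criticalTwoPoint_e₂ :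
    Real.tanh (criticalBeta 3) ≤ criticalTwoPoint 3 (Pi.single 1 1) := by
  have hA : Even #(({0} : Finset (Site 3)) ∆ {(Pi.single 1 1 : Site 3)}) :=
    even_card_singleton_symmDiff _ _
  have hB : Even #(∅ : Finset (Site 3)) := by simp
  have key := sourcedDoubleCurrentLawInf_real_bond_closed criticalBeta_three_pos hA hB zdGraph_adj_zero_e₂
  have hempty : (∅ : Finset (Site 3)) ∆ (({0} : Finset (Site 3)) ∆ {(Pi.single 1 1 : Site 3)}) =
      {0} ∆ {(Pi.single 1 1 : Site 3)} := by simp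
  rw [symmDiff_self, bot_eq_empty, freeCorr_criticalBeta_empty, hempty, freeCorr_criticalBeta_pair,
    sub_zero] at key
  set β := criticalBeta 3 with hβdef
  have hβ : 0 < β := criticalBeta_three_pos
  set g := criticalTwoPoint 3 (Pi.single 1 1) with hg
  have hgpos : 0 < g := criticalTwoPoint_pos3 _
  have hg1 : g ≤ 1 := criticalTwoPoint_le_one' _
  have hcosh : 0 < Real.cosh β := Real.cosh_pos β
  have hsinh : 0 ≤ Real.sinh β := Real.sinh_nonneg_iff.2 hβ.le
  -- the second factor is positive
  have h2 : 0 < (Real.cosh β * 1 - Real.sinh β * g) / 1 := by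
    rw [div_one, mul_one]
    have : Real.cosh β - Real.sinh β = Real.exp (-β) := Real.cosh_sub_sinh β
    nlinarith [Real.exp_pos (-β)]
  -- the product is a probability, hence nonnegative; so the first factor is nonnegative
  have h1 : 0 ≤ (Real.cosh β * g - Real.sinh β * 1) / g := by
    have hprod : 0 ≤ (Real.cosh β * g - Real.sinh β * 1) / g * ((Real.cosh β * 1 - Real.sinh β * g) / 1) := by
      rw [← key]; exact measureReal_nonneg
    exact nonneg_of_mul_nonneg_left hprod h2
  rw [mul_one, div_nonneg_iff] at h1
  rcases h1 with ⟨h1, -⟩ | ⟨-, h1⟩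
  · rw [Real.tanh_eq_sinh_div_cosh, div_le_iff₀ hcosh]
    linarith
  · exact absurd h1 (not_le.2 hgpos)

/-- Not merging forces the bond `0e₂` to be closed: `A_par`-type avoidance probabilities are at most
the closed-bond probability, `1 - P^{A,B}_β[0 ↔ e₂] ≤ P^{A,B}_β[0e₂ ∉ ω]`. [folklore] -/
theorem one_sub_openConn_le_bondClosed {β : ℝ} (hβ : 0 < β) {A B : Finset (Site 3)} (hA : Even #A)
    (hB : Even #B) {u v : Site 3} (huv : u ≠ v) :
    1 - (sourcedDoubleCurrentLawInf 3 β A B).real (openConn u v) ≤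
      (sourcedDoubleCurrentLawInf 3 β A B).real {ω | s(u, v) ∉ ω} := by
  haveI := isProbabilityMeasure_sourcedDoubleCurrentLawInf (d := 3) hβ hA hB
  have hmeas : MeasurableSet (openConn u v : Set (BondConfig (Site 3))) := measurableSet_openConn_holds u v
  rw [← probReal_add_probReal_compl (μ := sourcedDoubleCurrentLawInf 3 β A B) hmeas, add_sub_cancel_left]
  refine measureReal_mono ?_
  intro ω hω hb
  apply hω
  have hadj : (openGraph ω).Adj u v := (openGraph_adj ω u v).2 ⟨hb, huv⟩
  exact hadj.reachable

/-- **The exact closed-bond probability for the parallel pairing**: with `G = criticalTwoPoint 3`,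
`P^{{0}∆{x},{e₂}∆{x+e₂}}_{β_c}[0e₂ ∉ ω] = (cosh β_c - sinh β_c G(x-e₂)/G(x)) (cosh β_c - sinh β_c G(x+e₂)/G(x))`.
[cite: AizenmanDuminilCopinSidoraviciusCMP2015, §2.2, eqs. (2.13)–(2.14)] -/
theorem parBondClosed_eq (x : Site 3) :
    (sourcedDoubleCurrentLawInf 3 (criticalBeta 3) ({0} ∆ {x})
        ({(Pi.single 1 1 : Site 3)} ∆ {x + Pi.single 1 1})).real {ω | s((0 : Site 3), Pi.single 1 1) ∉ ω} =
      (Real.cosh (criticalBeta 3) -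
          Real.sinh (criticalBeta 3) * (criticalTwoPoint 3 (x - Pi.single 1 1) / criticalTwoPoint 3 x)) *
        (Real.cosh (criticalBeta 3) -
          Real.sinh (criticalBeta 3) * (criticalTwoPoint 3 (x + Pi.single 1 1) / criticalTwoPoint 3 x)) := by
  have key := sourcedDoubleCurrentLawInf_real_bond_closed criticalBeta_three_pos
    (even_card_singleton_symmDiff (0 : Site 3) x)
    (even_card_singleton_symmDiff (Pi.single 1 1 : Site 3) (x + Pi.single 1 1)) zdGraph_adj_zero_e₂
  have e1 : (({0} : Finset (Site 3)) ∆ {x}) ∆ ({0} ∆ {(Pi.single 1 1 : Site 3)}) =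
      {x} ∆ {(Pi.single 1 1 : Site 3)} := by
    rw [symmDiff_symmDiff_symmDiff_comm, symmDiff_self, bot_symmDiff]
  have e2 : (({(Pi.single 1 1 : Site 3)} : Finset (Site 3)) ∆ {x + Pi.single 1 1}) ∆
        ({0} ∆ {(Pi.single 1 1 : Site 3)}) = {x + Pi.single 1 1} ∆ {(0 : Site 3)} := by
    rw [symmDiff_comm ({(0 : Site 3)} : Finset (Site 3)), symmDiff_symmDiff_symmDiff_comm, symmDiff_self,
      bot_symmDiff]
  rw [e1, e2, freeCorr_criticalBeta_pair, freeCorr_criticalBeta_pair, freeCorr_criticalBeta_pair,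
    freeCorr_criticalBeta_pair, sub_zero, add_sub_cancel_right, zero_sub, criticalTwoPoint_neg,
    criticalTwoPoint_sub_comm (Pi.single 1 1) x] at key
  rw [key]
  have hG : criticalTwoPoint 3 x ≠ 0 := (criticalTwoPoint_pos3 x).ne'
  field_simp

/-- **The exact closed-bond probability for the crossed pairing**:
`P^{{0}∆{x+e₂},{e₂}∆{x}}_{β_c}[0e₂ ∉ ω] = (cosh β_c - sinh β_c G(x)/G(x+e₂)) (cosh β_c - sinh β_c G(x)/G(x-e₂))`.
[cite: AizenmanDuminilCopinSidoraviciusCMP2015, §2.2, eqs. (2.13)–(2.14)] -/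
theorem crossBondClosed_eq (x : Site 3) :
    (sourcedDoubleCurrentLawInf 3 (criticalBeta 3) ({0} ∆ {x + Pi.single 1 1})
        ({(Pi.single 1 1 : Site 3)} ∆ {x})).real {ω | s((0 : Site 3), Pi.single 1 1) ∉ ω} =
      (Real.cosh (criticalBeta 3) -
          Real.sinh (criticalBeta 3) * (criticalTwoPoint 3 x / criticalTwoPoint 3 (x + Pi.single 1 1))) *
        (Real.cosh (criticalBeta 3) -
          Real.sinh (criticalBeta 3) * (criticalTwoPoint 3 x / criticalTwoPoint 3 (x - Pi.single 1 1))) := by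
  have key := sourcedDoubleCurrentLawInf_real_bond_closed criticalBeta_three_pos
    (even_card_singleton_symmDiff (0 : Site 3) (x + Pi.single 1 1))
    (even_card_singleton_symmDiff (Pi.single 1 1 : Site 3) x) zdGraph_adj_zero_e₂
  have e1 : (({0} : Finset (Site 3)) ∆ {x + Pi.single 1 1}) ∆ ({0} ∆ {(Pi.single 1 1 : Site 3)}) =
      {x + Pi.single 1 1} ∆ {(Pi.single 1 1 : Site 3)} := by
    rw [symmDiff_symmDiff_symmDiff_comm, symmDiff_self, bot_symmDiff]
  have e2 : (({(Pi.single 1 1 : Site 3)} : Finset (Site 3)) ∆ {x}) ∆ ({0} ∆ {(Pi.single 1 1 : Site 3)}) =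
      {x} ∆ {(0 : Site 3)} := by
    rw [symmDiff_comm ({(0 : Site 3)} : Finset (Site 3)), symmDiff_symmDiff_symmDiff_comm, symmDiff_self,
      bot_symmDiff]
  rw [e1, e2, freeCorr_criticalBeta_pair, freeCorr_criticalBeta_pair, freeCorr_criticalBeta_pair,
    freeCorr_criticalBeta_pair, sub_zero, zero_sub, criticalTwoPoint_neg, sub_add_cancel_right,
    criticalTwoPoint_neg] at key
  rw [key]
  have hG1 : criticalTwoPoint 3 (x + Pi.single 1 1) ≠ 0 := (criticalTwoPoint_pos3 _).ne'
  have hG2 : criticalTwoPoint 3 (x - Pi.single 1 1) ≠ 0 := (criticalTwoPoint_pos3 _).ne'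
  field_simp

end Summit.CriticalPhenomena.Ising3DConformalLimit.EnergyNotSigmaSquaredEnergyGapSoft

end
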